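import Literature.AlgebraicGeometry.ComplexMultiplication.IndependentCMFieldsHodge
import Literature.AlgebraicGeometry.Pohlmann1968.NondegenerateCMTypeDivisorGenerated
import Literature.AlgebraicGeometry.ComplexMultiplication.QuarticCMTypeReflectionConjugationSquare
import Literature.AlgebraicGeometry.ComplexMultiplication.SimpleIffPrimitiveCMType
import Literature.NumberTheory.ComplexMultiplication.CMTypeRankBlockConjugation
import Literature.NumberTheory.ComplexMultiplication.QuarticCMTypes
import Literature.NumberTheory.ComplexMultiplication.CMTypeRankCommonConstituent
import HarnessLib

/-!
# Imaginary quadratic fields against quartic CM fields: conjugation is a square in `Aut(ℂ)` on `Hom(K, ℂ)` for every quartic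
# CM field with a primitive type (cyclic Galois or non-Galois), and splitting of nondegeneracy along a block partial conjugation

(Part 1) For a Galois CM field whose complex conjugation is a square `g²` in `Gal(K/ℚ)` — in particular a CYCLIC group of
order `≡ 0 (mod 4)` — some `τ ∈ Aut(ℂ)` satisfies `τ ∘ τ ∘ s = s̄` for every embedding `s` ((□)); (Part 2) a quartic CM
field that is Galois and carries a PRIMITIVE CM type is cyclic, and a primitive quartic type is nondegenerate (Ribet's bound
in degree `≤ 6`, the tree's `Pohlmann1968.isNondegenerate_of_isPrimitive_of_finrank_le_six`); (Part 3) (□) for EVERY quartic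
CM field with a primitive type, `|⊔_i Hom(K_i, ℂ)| = Σ_i [K_i:ℚ]`, and the splitting of nondegeneracy of a family of CM types
along a BLOCK PARTIAL CONJUGATION `σ` (conjugation on the slots of `B`, identity off `B`): the family is nondegenerate iff both
sub-families are (`isNondegenerateFamily_iff_of_block`); (Part 4) transfer of equality of two automorphisms of `ℂ` from the
embeddings of `K` to those of a field `M` whose embeddings take values in the Galois closure of `K`.

* Part 1 — from `CorCM/ImaginaryQuadraticTimesConjSquareCMHodge` (3/18 declarations; namespace
  `Literature.AlgebraicGeometry.ComplexMultiplication.ConjSquare`): `E^a × A^b` for a CM elliptic curve `E` and a CM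
  abelian variety `A` whose CM field `K` has COMPLEX CONJUGATION A. Declarations:
  `exists_eq_comp_algEquiv_of_isGalois`, `exists_ringAut_smul_smul_eq_conjugate_of_isSquare_conjGal`,
  `exists_ringAut_smul_smul_eq_conjugate_of_isCyclic`.
* Part 2 — from `CorCM/ImaginaryQuadraticTimesSimpleCMSurfaceHodge` (2/9 declarations; namespace
  `Literature.AlgebraicGeometry.ComplexMultiplication.QuarticCM`): `E^a × S^b` for a CM elliptic curve `E` and a
  SIMPLE CM abelian surface `S`: `B• = D•` and the Hodge conjecture,. Declarations: `isCyclic_of_isPrimitive`,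
  `isNondegenerate_of_isPrimitive`.
* Part 3 — from `CorCM/ImaginaryQuadraticsTimesConjSquareCMHodge` (3/19 declarations; namespace
  `Literature.AlgebraicGeometry.ComplexMultiplication.QuarticCM`): `E_1^{a_1} × ⋯ × E_r^{a_r} × A^b`: SEVERAL pairwise
  non-isogenous CM elliptic curves times a CM abelian variety whose CM. Declarations:
  `exists_ringAut_smul_smul_eq_conjugate_of_isPrimitive`, `card_sigma_ringHom_eq_sum`,
  `isNondegenerateFamily_iff_of_block`.
* Part 4 — from `CorCM/DihedralReflexSwapReflect` (1/8 declarations; namespace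
  `Literature.AlgebraicGeometry.ComplexMultiplication`): The mixed dihedral pair, I: the swap–reflection `g = τσ₀` and
  the irreducibility of `U(Ψ)` for a non-Galois quartic. Declarations: `smul_eq_smul_of_forall_smul_eq`.

## References

* [Gordon1999HodgeAVSurvey] B. B. Gordon, *A survey of the Hodge conjecture for abelian varieties*, §3 Theorem (Imai,
  Murty) with proof; 7.5; 10.10.
* [Lang2002] S. Lang, *Algebra*, 3rd ed., I §6 (groups of order `8`), VI §1 Cor. 1.4, V §3 Thm. 3.3.
* [Shimura1998] G. Shimura, *Abelian Varieties with Complex Multiplication and Modular Functions*, §8.1 Prop. 25, §8.4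
  (2).
* [MoonenZarhin1999LowDim] B. Moonen, Yu. Zarhin, Math. Ann. 315 (1999) 711–733, section "Hodge groups of simple
  abelian surfaces of CM-type".
* [Deligne1982HodgeCycles] P. Deligne, *Hodge cycles on abelian varieties*, LNM 900 (1982), I Ex. 3.7.

Provenance: Literature home of the used declarations of the Summits-side modules listed part by part above (cells
`pub-hodge-ring2` / `pub-hodgecm2`; namespaces `Summit.HodgeConjecture.CorCM`,
`Summit.HodgeConjecture.CorCM.ConjSquare`, `Summit.HodgeConjecture.CorCM.QuarticCM` re-rooted under
`Literature.AlgebraicGeometry.…` as stated), whose imports are `Literature/` and Mathlib only for the declarations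
used; re-homed verbatim (proofs unchanged) so that Literature users are served without importing `Summits/`. Lane
`lit-hodgefound`, seat p20 (generation 34). Theorems only: no definition, no named fact, no `sorry`; axioms `propext`,
`Classical.choice`, `Quot.sound`.
-/

/-! ## Part 1: ImaginaryQuadraticTimesConjSquareCMHodge -/

noncomputable section

open NumberField NumberField.ComplexEmbedding IntermediateField

/-! ## §1 Group theory: a central involution of a nonabelian group of order `8` is a square -/

namespace Literature.AlgebraicGeometry.ComplexMultiplication.ConjSquare

/-! ## §2 Galois CM fields: (□) from a square root of complex conjugation in `Gal(K/ℚ)` -/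

section Galois

open Literature.NumberTheory.ComplexMultiplication
open Literature.AlgebraicGeometry.Pohlmann1968
open Literature.AlgebraicGeometry.ComplexMultiplication.CyclicSextic (conjugate_eq_comp_conjGal)

variable {K : Type} [Field K] [NumberField K] [IsCMField K]

omit [IsCMField K] in
/-- For `K/ℚ` Galois every complex embedding is `s₀ ∘ w`, `w ∈ Gal(K/ℚ)` (`w ↦ s₀ ∘ w` is injective between two sets of
`[K:ℚ]` elements); cf. `QuarticCM.exists_eq_comp_algEquiv` in `CorCM/QuarticCMTypeSlice` (same statement, heavier
imports). [cite: Lang2002, I §6] -/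
theorem exists_eq_comp_algEquiv_of_isGalois [IsGalois ℚ K] (s₀ s : K →+* ℂ) :
    ∃ w : K ≃ₐ[ℚ] K, s = s₀.comp w.toRingEquiv.toRingHom := by
  classical
  have hinj : Function.Injective fun w : K ≃ₐ[ℚ] K => s₀.comp w.toRingEquiv.toRingHom := fun _ _ h =>
    AlgEquiv.ext fun x => s₀.injective (RingHom.congr_fun h x)
  have hbij : Function.Bijective fun w : K ≃ₐ[ℚ] K => s₀.comp w.toRingEquiv.toRingHom := by
    rw [Fintype.bijective_iff_injective_and_card]
    refine ⟨hinj, ?_⟩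
    rw [← Nat.card_eq_fintype_card, IsGalois.card_aut_eq_finrank, Embeddings.card]
  obtain ⟨w, hw⟩ := hbij.2 s
  exact ⟨w, hw.symm⟩

/-- **(□) for a Galois CM field whose complex conjugation is a square in `Gal(K/ℚ)`**: if `ρ = g²` (`ρ = conjGal`), an
automorphism `τ` of `ℂ` with `τ ∘ s₀ = s₀ ∘ g` (transitivity of `Aut(ℂ)` on `Hom(K, ℂ)`) has `τ ∘ τ ∘ s = s̄` for every
`s = s₀ ∘ w`. [cite: Shimura1998, §8.1 Prop. 25] [cite: Lang2002, VI §1 Cor. 1.4] -/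
theorem exists_ringAut_smul_smul_eq_conjugate_of_isSquare_conjGal [IsGalois ℚ K]
    (hsq : IsSquare (conjGal : K ≃ₐ[ℚ] K)) : ∃ τ : ℂ ≃+* ℂ, ∀ s : K →+* ℂ, τ • τ • s = conjugate s := by
  obtain ⟨g, hg⟩ := hsq
  obtain ⟨s₀⟩ : Nonempty (K →+* ℂ) := inferInstance
  haveI := isPretransitive_ringEquiv_complex (K := K)
  obtain ⟨τ, hτ⟩ := MulAction.exists_smul_eq (ℂ ≃+* ℂ) s₀ (s₀.comp g.toRingEquiv.toRingHom)
  have hcomp : ∀ (w : K ≃ₐ[ℚ] K), τ • s₀.comp w.toRingEquiv.toRingHom =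
      (s₀.comp g.toRingEquiv.toRingHom).comp w.toRingEquiv.toRingHom := fun w => by
    rw [← hτ]; rfl
  refine ⟨τ, fun s => ?_⟩
  obtain ⟨w, rfl⟩ := exists_eq_comp_algEquiv_of_isGalois s₀ s
  have e1 : τ • s₀.comp w.toRingEquiv.toRingHom = s₀.comp (g * w).toRingEquiv.toRingHom := by
    rw [hcomp]; exact RingHom.ext fun _ => rfl
  have e2 : τ • s₀.comp (g * w).toRingEquiv.toRingHom = s₀.comp (g * (g * w)).toRingEquiv.toRingHom := by
    rw [hcomp]; exact RingHom.ext fun _ => rfl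
  rw [e1, e2, ← mul_assoc, ← hg, conjugate_eq_comp_conjGal, conjGal_central w]
  exact RingHom.ext fun _ => rfl

/-- **(□) for a Galois CM field with CYCLIC group of order `≡ 0 (mod 4)`** (complex conjugation is an involution of a
cyclic group of order `4m`, hence a square — b23's `isSquare_of_mul_self_eq_one_of_isCyclic`). [cite: Lang2002, VI §1 Cor. 1.4] -/
theorem exists_ringAut_smul_smul_eq_conjugate_of_isCyclic [IsGalois ℚ K] [IsCyclic (K ≃ₐ[ℚ] K)]
    (h4 : 4 ∣ Module.finrank ℚ K) : ∃ τ : ℂ ≃+* ℂ, ∀ s : K →+* ℂ, τ • τ • s = conjugate s :=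
  exists_ringAut_smul_smul_eq_conjugate_of_isSquare_conjGal
    (isSquare_of_mul_self_eq_one_of_isCyclic (by rwa [IsGalois.card_aut_eq_finrank]) conjGal_mul_conjGal)

end Galois

end Literature.AlgebraicGeometry.ComplexMultiplication.ConjSquare

/-! ## §4 The two-slot family `(k, K)` under (□) -/

end

/-! ## Part 2: ImaginaryQuadraticTimesSimpleCMSurfaceHodge -/

noncomputable section

open _root_.CategoryTheory _root_.CategoryTheory.Limits NumberField NumberField.ComplexEmbedding IntermediateField

/-! ## §1 A Galois quartic CM field with a primitive CM type is cyclic -/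

namespace Literature.AlgebraicGeometry.ComplexMultiplication.QuarticCM

open Literature.NumberTheory.ComplexMultiplication
open Literature.AlgebraicGeometry.Motives (CMType)
open Literature.AlgebraicGeometry.Pohlmann1968

variable {K : Type} [Field K] [NumberField K] [IsCMField K]

/-- **A quartic CM field that is Galois over `ℚ` and carries a PRIMITIVE CM type has CYCLIC Galois group**: were the
group non-cyclic (exponent `2`), `Φ = {a, a ∘ h}` with `h² = 1`, and no translate of `Φ` separates `a` from `a ∘ h`
(`forall_smul_mem_iff_of_mul_self_eq_one`), against Kubota's criterion `isPrimitive_iff_forall_eq`.  Equivalently: a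
biquadratic CM field has no primitive CM type (its abelian surfaces split). [cite: Shimura1998, §8.4 (2)] -/
theorem isCyclic_of_isPrimitive [IsGalois ℚ K] (h4 : Module.finrank ℚ K = 4) {Φ : CMType K} {φ₀ : K →+* ℂ}
    (hprim : IsPrimitive (ℂ ≃+* ℂ) Φ.1 φ₀) : IsCyclic (K ≃ₐ[ℚ] K) := by
  by_contra hK
  obtain ⟨a, b, hba, hba', hΦ⟩ := exists_mem_mem_ne h4 Φ
  obtain ⟨h, hb⟩ := exists_eq_comp_algEquiv a b
  have hh : h * h = 1 := mul_self_eq_one_of_not_isCyclic h4 hK h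
  have hΦ' : ∀ s, s ∈ Φ.1 ↔ s = a ∨ s = a.comp h.toRingEquiv.toRingHom := fun s => by rw [hΦ s, hb]
  haveI := isPretransitive_ringEquiv_complex (K := K)
  have hsep : a = b := (isPrimitive_iff_forall_eq Φ.1 φ₀).1 hprim a b fun τ => by
    rw [hb]
    exact forall_smul_mem_iff_of_mul_self_eq_one hh hΦ' τ
  exact hba hsep.symm

/-- For a quartic CM field a primitive CM type is nondegenerate (Ribet's bound in degree `≤ 6`,
`Pohlmann1968.isNondegenerate_of_isPrimitive_of_finrank_le_six`). [cite: Shimura1998, §8.4 (2)] -/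
theorem isNondegenerate_of_isPrimitive (h4 : Module.finrank ℚ K = 4) (Φ : CMType K) {φ₀ : K →+* ℂ}
    (hprim : IsPrimitive (ℂ ≃+* ℂ) Φ.1 φ₀) : IsNondegenerate Φ :=
  isNondegenerate_of_isPrimitive_of_finrank_le_six Φ (by rw [h4]; norm_num) φ₀ hprim

end Literature.AlgebraicGeometry.ComplexMultiplication.QuarticCM

/-! ## §2 The two-slot family `(k, K)`, `K` quartic with a primitive type / a simple realisation -/

end

/-! ## Part 3: ImaginaryQuadraticsTimesConjSquareCMHodge -/

noncomputable section

open _root_.CategoryTheory _root_.CategoryTheory.Limits NumberField NumberField.ComplexEmbedding IntermediateField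
open scoped BigOperators

/-! ## §0 (□) for a quartic CM field carrying a primitive CM type -/

namespace Literature.AlgebraicGeometry.ComplexMultiplication.QuarticCM

open Literature.NumberTheory.ComplexMultiplication
open Literature.AlgebraicGeometry.Motives (CMType)
open Literature.AlgebraicGeometry.Pohlmann1968

variable {K : Type} [Field K] [NumberField K] [IsCMField K]

/-- **(□) for every quartic CM field carrying a PRIMITIVE CM type**: complex conjugation on `Hom(K, ℂ)` is the square of
an automorphism of `ℂ` — for `K` Galois the group is cyclic of order `4` (`isCyclic_of_isPrimitive`: biquadratic fields
carry no primitive type) and `ρ = g²`; for `K` not Galois the `4`-cycle `(a b ā b̄)` of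
`exists_ringAut_smul_smul_eq_conjugate`. [cite: Shimura1998, §8.4 (2)] [cite: Lang2002, VI §1 Cor. 1.4] -/
theorem exists_ringAut_smul_smul_eq_conjugate_of_isPrimitive (h4 : Module.finrank ℚ K = 4) {Φ : CMType K}
    {φ₀ : K →+* ℂ} (hprim : IsPrimitive (ℂ ≃+* ℂ) Φ.1 φ₀) :
    ∃ τ : ℂ ≃+* ℂ, ∀ s : K →+* ℂ, τ • τ • s = conjugate s := by
  by_cases hG : IsGalois ℚ K
  · haveI := isCyclic_of_isPrimitive h4 hprim
    exact ConjSquare.exists_ringAut_smul_smul_eq_conjugate_of_isCyclic (dvd_of_eq h4.symm)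
  · exact exists_ringAut_smul_smul_eq_conjugate h4 hG

end Literature.AlgebraicGeometry.ComplexMultiplication.QuarticCM

namespace Literature.AlgebraicGeometry.ComplexMultiplication

open Literature.NumberTheory.ComplexMultiplication
open Literature.AlgebraicGeometry.Motives (AbelianVariety CMType)
open Literature.AlgebraicGeometry.HodgeTheory
open Literature.AlgebraicGeometry.Pohlmann1968

/-! ## §1 Block partial conjugations at the level of CM fields -/

section Block

variable {I : Type} {K : I → Type} [∀ i, Field (K i)] [∀ i, NumberField (K i)] [∀ i, IsCMField (K i)] [Fintype I]

omit [∀ i, IsCMField (K i)] in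
/-- `|⊔_i Hom(K_i, ℂ)| = Σ_i [K_i : ℚ]`. [cite: MoonenZarhin1999LowDim, Cor. (3.9)] -/
private theorem card_sigma_ringHom_eq_sum :
    Fintype.card ((i : I) × (K i →+* ℂ)) = ∑ i, Module.finrank ℚ (K i) := by
  rw [Fintype.card_sigma]
  exact Finset.sum_congr rfl fun i _ => Embeddings.card (K i) ℂ

/-- **Splitting of nondegeneracy along a block of CM fields**: under a block partial conjugation `σ` as above, the family
`(Φ_i)_{i∈I}` is nondegenerate iff BOTH sub-families `(Φ_i)_{i∈B}` and `(Φ_i)_{i∉B}` are (the product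
`∏_{i∈B} A_{Φ_i} × ∏_{i∉B} A_{Φ_i}` is stably nondegenerate iff both factors are; Gordon 7.5 (3)).
[cite: Gordon1999HodgeAVSurvey, §3 Theorem and 7.5] -/
theorem isNondegenerateFamily_iff_of_block (p : I → Prop) [DecidablePred p] {σ : ℂ ≃+* ℂ}
    (hσ : ∀ i, p i → ∀ s : K i →+* ℂ, σ • s = conjugate s) (hσ' : ∀ i, ¬p i → ∀ s : K i →+* ℂ, σ • s = s)
    (hp : ∃ i, p i) (hnp : ∃ i, ¬p i) (Φ : ∀ i, CMType (K i)) :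
    CMAlgebra.IsNondegenerateFamily Φ ↔
      CMAlgebra.IsNondegenerateFamily (fun i : {i // p i} => Φ i.1) ∧
        CMAlgebra.IsNondegenerateFamily (fun i : {i // ¬p i} => Φ i.1) := by
  rw [CMAlgebra.isNondegenerateFamily_iff, CMAlgebra.isNondegenerateFamily_iff, CMAlgebra.isNondegenerateFamily_iff,
    ← card_sigma_ringHom_eq_sum (K := K), ← card_sigma_ringHom_eq_sum (K := fun i : {i // p i} => K i.1),
    ← card_sigma_ringHom_eq_sum (K := fun i : {i // ¬p i} => K i.1)]
  exact typeRank_sigmaType_eq_iff_of_block (G := ℂ ≃+* ℂ) (Φ := fun i => (Φ i).1) p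
    (fun i => isCMTypeWith_conj (Φ i)) (fun i hi s => by rw [hσ i hi s, conj_smul_eq_conjugate]) hσ' hp hnp

end Block

end Literature.AlgebraicGeometry.ComplexMultiplication

end

/-! ## Part 4: DihedralReflexSwapReflect -/

noncomputable section

open NumberField NumberField.ComplexEmbedding IntermediateField

namespace Literature.AlgebraicGeometry.ComplexMultiplication

open Literature.NumberTheory.ComplexMultiplication
open Literature.AlgebraicGeometry.Pohlmann1968
open QuarticCM

namespace DihedralReflexPair

/-! ### §1 Transfer from `Hom(K, ℂ)` to `Hom(M, ℂ)` -/

section TwoFields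

variable {K M : Type} [Field K] [NumberField K] [IsCMField K] [Field M] [NumberField M] [IsCMField M]

omit [IsCMField K] [NumberField M] [IsCMField M] in
/-- **Transfer.**  If every complex embedding of `M` takes values in the Galois closure `L` of `K` in `ℂ`, two
automorphisms of `ℂ` that agree on every embedding of `K` (hence on `L`) agree on every embedding of `M`.
[cite: Shimura1998, §8.4 Example (2)(C)] -/
theorem smul_eq_smul_of_forall_smul_eq (hMK : ∀ (t : M →+* ℂ) (y : M), t y ∈ normalClosure ℚ K ℂ)
    {γ γ' : ℂ ≃+* ℂ} (hK : ∀ s : K →+* ℂ, γ • s = γ' • s) (t : M →+* ℂ) : γ • t = γ' • t := by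
  have h1 : ∀ s : K →+* ℂ, (γ'⁻¹ * γ) • s = s := fun s => by rw [mul_smul, hK s, inv_smul_smul]
  refine RingHom.ext fun y => ?_
  have h2 : (γ'⁻¹ * γ) (t y) = t y := apply_eq_self_of_mem_normalClosure h1 (hMK t y)
  have h3 : γ' (γ'⁻¹ (γ (t y))) = γ' (t y) := congrArg γ' h2
  rw [show γ'⁻¹ = γ'.symm from rfl, γ'.apply_symm_apply] at h3
  exact h3

end TwoFields

end DihedralReflexPair

end Literature.AlgebraicGeometry.ComplexMultiplication

end
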